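import Summits.Langlands.Langlands.Theorems.IrreducibilityBySelfDualityReciprocityUpToIrreducibilityWeakAutomorphyOfFontaineMazur
import Summits.Langlands.Langlands.Theses.IrreducibilityBySelfDuality
import HarnessLib

/-!
# Tightness of line `Sketch` for the crux `ReciprocityUpToIrreducibility` (item stmt-Langlands-14328), II:
# the crux implies lang.S03 (`FontaineMazurLanglandsGLn`) at the pinned family of period-ring data

Support file (closes nothing; continuation lead c2).  The registered open stub
`stub_fontaineMazurLanglandsGLn` of line `Sketch` is the accepted Literature text lang.S03
`FontaineMazurLanglandsGLn 𝔅 n` for every rank `n`, at the PINNED family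
`𝔅 K ℓ v hv := ⟨(fontainePstAdicCompletion v ℓ hv).algebra, (fontainePstAdicCompletion v ℓ hv).𝔅⟩`;
the former stub B_w follows from it (`stub_weakAutomorphy_of_fontaineMazurLanglandsGLn`, p117444).
Here the CONVERSE direction of that model gap is closed: the crux `E` implies the stub verbatim
(`fontaineMazurLanglandsGLn_pinned_of_reciprocityUpToIrreducibility`).  Given an irreducible `r` with a
global finite model `rE` whose `ℚ_ℓ`-restriction is geometric for the pinned family, `r` is geometric
in the summit's pinned sense (`isGeometricPinned_of_isGeometric_restrictScalarsQl`: unramifiedness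
a.e. passes through change of coefficients and of frame; de Rham-ness at `v ∣ ℓ` of `r|_{Γ_{K_v}}` for
the pinned datum is, by definition, admissibility of the `ℚ_ℓ`-restriction of SOME local finite model,
and the global model restricts to one — `HasQlModel.toLocal`, `GaloisRep.toLocal_restrictScalarsQl`),
so direction (B) of `E` produces the automorphic `π`; rank `0` is vacuous (no irreducible
representation on the zero space).  With `…Tightness.lean` this completes the picture: every open
stub of the line except the Literature debt `stub_jsPole` (and the gluing-shaped
`stub_pairCompatibilityAbove`) is implied by the crux.  No definitions; std axioms.
-/

noncomputable section

set_option linter.dupNamespace false -- project-wide option (lakefile weak.linter.dupNamespace); `Summit.Langlands.Langlands` is the mandated namespace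

open scoped MatrixGroups NumberField Classical
open Filter IsDedekindDomain
open Literature.NumberTheory.Automorphic Literature.NumberTheory.GaloisRepresentations
open Summit.Langlands
open Summit.Langlands.Langlands.Theses.IrreducibilityBySelfDuality

namespace Summit.Langlands.Langlands.Theorems.ReciprocityUpToIrreducibility

variable {K : Type} [Field K] [NumberField K] {ℓ : ℕ} [Fact ℓ.Prime] {n : ℕ}

/-- **lang.S03's hypothesis gives pinned geometricity.**  If `r : Γ_K → GL_n(ℚ̄_ℓ)` has a global
finite model `rE` over `E ⊆ ℚ̄_ℓ` whose `ℚ_ℓ`-restriction is geometric (accepted `GaloisRep.IsGeometric`)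
for the pinned family of period-ring data, then `r` is unramified at almost all places and de Rham at
every `v ∣ ℓ` for Fontaine's pinned datum (the summit's `IsGeometricFramed`, which ignores `Rec`).
[cite: FontaineAsterisque223III, Prop. 1.5.2] [cite: BuzzardGeeLMS2014, §2.2] -/
theorem isGeometricPinned_of_isGeometric_restrictScalarsQl
    {r : FramedGaloisRep K (PadicAlgCl ℓ) n} {E : IntermediateField ℚ_[ℓ] (PadicAlgCl ℓ)}
    [FiniteDimensional ℚ_[ℓ] E] {rE : FramedGaloisRep K E n} (hmodel : HasQlModel r E rE)
    (hgeo : (restrictScalarsQl E rE).IsGeometric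
      fun (v : HeightOneSpectrum (𝓞 K)) (hv : ((ℓ : ℕ) : 𝓞 K) ∈ v.asIdeal) =>
        ⟨(Literature.NumberTheory.PAdicHodge.fontainePstAdicCompletion v ℓ hv).algebra,
          (Literature.NumberTheory.PAdicHodge.fontainePstAdicCompletion v ℓ hv).𝔅⟩) :
    (∀ᶠ v : HeightOneSpectrum (𝓞 K) in cofinite, r.IsUnramifiedAt v) ∧
      ∀ (v : HeightOneSpectrum (𝓞 K)) (hv : ((ℓ : ℕ) : 𝓞 K) ∈ v.asIdeal),
        (Literature.NumberTheory.PAdicHodge.fontainePstAdicCompletion v ℓ hv).IsDeRhamFramed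
          (r.toLocal v) := by
  refine ⟨?_, fun v hv => ?_⟩
  · obtain ⟨S, hS, hur⟩ := hgeo.1
    obtain ⟨P, rfl⟩ := hmodel
    refine Filter.mem_of_superset hS.compl_mem_cofinite fun v hv => ?_
    have h1 : rE.IsUnramifiedAt v := (isUnramifiedAt_restrictScalarsQl_iff E rE v).1 (hur v hv)
    exact (FramedGaloisRep.isUnramifiedAt_conj_iff v P _).2
      ((FramedGaloisRep.isUnramifiedAt_baseChange_iff _ _
        (algebraMap E (PadicAlgCl ℓ)).injective v rE).2 h1)
  · rw [(Literature.NumberTheory.PAdicHodge.fontainePstAdicCompletion v ℓ hv).isDeRhamFramed_iff_of_hasQlModel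
      (hmodel.toLocal v), ← GaloisRep.toLocal_restrictScalarsQl]
    exact hgeo.2 v hv

/-- **Tightness, lang.S03: the crux implies the registered open stub `stub_fontaineMazurLanglandsGLn`
(verbatim)** — the Fontaine–Mazur–Langlands text for `GL_n`, every rank, at the pinned family of
period-ring data: an irreducible `r` with a geometric global finite model is pinned-geometric
(`isGeometricPinned_of_isGeometric_restrictScalarsQl`), so direction (B) of the crux gives an
L-algebraic cuspidal `π` Satake–Frobenius compatible with `r` at almost all places; rank `0` carries no
irreducible representation. [cite: FontaineMazurGeometric1995, Conj. 1] [cite: BuzzardGeeLMS2014, Conj. 3.2.2] -/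
theorem fontaineMazurLanglandsGLn_pinned_of_reciprocityUpToIrreducibility
    (hE : ReciprocityUpToIrreducibility) :
    ∀ n : ℕ, FontaineMazurLanglandsGLn
      (fun (K : Type) [Field K] [NumberField K] (ℓ : ℕ) [Fact ℓ.Prime]
          (v : HeightOneSpectrum (𝓞 K)) (hv : ((ℓ : ℕ) : 𝓞 K) ∈ v.asIdeal) =>
        ⟨(Literature.NumberTheory.PAdicHodge.fontainePstAdicCompletion v ℓ hv).algebra,
          (Literature.NumberTheory.PAdicHodge.fontainePstAdicCompletion v ℓ hv).𝔅⟩) n := by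
  intro n K _ _ hcpt ℓ _ ι E _ rE r hmodel hirr hgeo
  rcases Nat.eq_zero_or_pos n with rfl | hn
  · exfalso
    haveI := hirr
    have hbt : (⊥ : Subrepresentation r.toGaloisRep.toRepresentation) = ⊤ :=
      Subrepresentation.toSubmodule_injective (Subsingleton.elim _ _)
    exact (IsSimpleOrder.bot_ne_top (α := Subrepresentation r.toGaloisRep.toRepresentation)) hbt
  · obtain ⟨Rec, hRec⟩ := hE K
    obtain ⟨-, hB⟩ := hRec n hn hcpt
    obtain ⟨π, hL, hcorr⟩ := hB ℓ ι r hirr (isGeometricPinned_of_isGeometric_restrictScalarsQl hmodel hgeo)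
    exact ⟨π, hL, hcorr.1⟩

/-- **Registered stub `stub_fontaineMazurLanglandsGLnPinned_of_crux` of line `Sketch` (crux
stmt-Langlands-14328), verbatim**: the crux implies lang.S03 at the pinned family, every rank.
[cite: FontaineMazurGeometric1995, Conj. 1] -/
theorem stub_fontaineMazurLanglandsGLnPinned_of_crux :
    Summit.Langlands.Langlands.Theses.IrreducibilityBySelfDuality.ReciprocityUpToIrreducibility →
      ∀ n : ℕ, FontaineMazurLanglandsGLn
        (fun (K : Type) [Field K] [NumberField K] (ℓ : ℕ) [Fact ℓ.Prime]
            (v : HeightOneSpectrum (𝓞 K)) (hv : ((ℓ : ℕ) : 𝓞 K) ∈ v.asIdeal) =>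
          ⟨(Literature.NumberTheory.PAdicHodge.fontainePstAdicCompletion v ℓ hv).algebra,
            (Literature.NumberTheory.PAdicHodge.fontainePstAdicCompletion v ℓ hv).𝔅⟩) n :=
  fontaineMazurLanglandsGLn_pinned_of_reciprocityUpToIrreducibility

end Summit.Langlands.Langlands.Theorems.ReciprocityUpToIrreducibility

end
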